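import Literature.AlgebraicGeometry.AbelianSchemes.AbelianSchemeSymplecticLevelTransfer
import HarnessLib

/-!
# Transport of a symplectic lift along a fibre isomorphism WITH A CHANGE OF LEVEL
# ([Lan2013PELCompactifications] Lemma 1.3.6.5 read at two levels `N ∣ M` of one tower `α̂ : ẑ^{2g} ⥲ T̂ A_s̄`)

Layer `Literature/AlgebraicGeometry/AbelianSchemes`, namespace `Literature.AlgebraicGeometry.AbelianSchemes.AbelianSchemeOver`.
THEOREMS ONLY (no definition, no named fact, no instance, no `sorry`).  Cell `hodgecm-mathlib` (D-0151), F-DAG F-10 (b)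
step (b4) «the cover», byte (2b) (author B-p02 (g13)); count-neutral capital.  HC_CM is proved only modulo the 7 printed
citations until rung 0 closes; nothing here is about HC.

★ (T1) `LevelStructure.SymplecticLift.nonempty_transport` (file `AbelianSchemeSymplecticLevelTransfer`) transports a
symplectic lift `Λ` of a level-`N` structure `φ` at the geometric point `s` of `A/S` along an isomorphism of fibre abelian
varieties `e : A′_{s′} ≅ A_s` to a lift of a level-`N` structure `φ′` at `s′`, provided `e` carries the sections of `φ′` at
`s′` to those of `φ` at `s` — and returns `Nonempty`, hiding the transported tower `e⁻¹ ∘ Λ.lift`.  The pointwise step of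
F-10 (b4) needs the same transport together with a RISE OF LEVEL: the target is a level-`M` structure `ψ` on `A′`
(`N ∣ M`) whose sections at `s′` are carried by `e` onto the LEVEL-`M` STAGE `Λ.lift M (eᵢ)` of the tower (not onto
`φ(s)`).  Since a symplectic lift IS a compatible tower over all levels divisible by the level of its structure
([Lan2013PELCompactifications] Def. 1.3.6.2: «for each `l` such that `n∣l` and `l∣m`, the pullback of `(α_l, ν_l)` … is the
reduction mod `l` of `(α_m, ν_m)`»), the tower of `Λ` restricted to the levels `M ∣ M″` is such a lift of `ψ` once
transported along `e` — this file proves exactly that: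

* **`LevelStructure.SymplecticLift.nonempty_transport_relevel`** — given `e : A′_{s′} ≅ A_s`, `N ∣ M`, a lift `Λ` of
  `φ` (level `N`) at `s` for `Θ`, a level-`M` structure `ψ` on `A′`, and `he : e(ψᵢ(s′)) = Λ.lift M (eᵢ)` for all `i`,
  there is a lift of `ψ` at `s′` for `e^*Θ` (same roots `ζ`, tower `e⁻¹ ∘ Λ.lift` on the levels `M ∣ M″`, pairing clause
  by Mumford's functoriality ★ `weilPairingLevel_pullback_eq`).  ★ (T1) is the case `M = N`, `ψ = φ′` (by ★ `lift_level`);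
* `LevelStructure.SymplecticLift.nonempty_relevel` — the case `A′ = A`, `e = 𝟙`: a lift of `φ` at `s` is a lift of every
  level-`M` structure `ψ` on `A` with `ψᵢ(s) = Λ.lift M (eᵢ)` (the constructor inside ★ `LevelStructureRefinement` §4, as
  a named theorem for an arbitrary base).

## References
* [Lan2013PELCompactifications] K.-W. Lan, *Arithmetic compactifications of PEL-type Shimura varieties* (2013), §1.3.6
  Def. 1.3.6.2 (p. 80), Lemma 1.3.6.5 (p. 81), Lemma 1.3.6.6 and Cor. 1.3.6.7 (pp. 81–82).
* [MumfordAV1970] D. Mumford, *Abelian Varieties* (1970), §20, property (3) of `e_n` (p. 186).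
* Tree: ★ `AbelianSchemeSymplecticLevel` (`SymplecticLift`), ★ `AbelianSchemeSymplecticLevelTransfer` (T0/T1/T2),
  ★ `Motives.AbelianVarietyWeilPairingPullback` (`weilPairingLevel_pullback_eq`).
-/

noncomputable section

universe u

open CategoryTheory CategoryTheory.Limits AlgebraicGeometry

namespace Literature.AlgebraicGeometry.AbelianSchemes

namespace AbelianSchemeOver

open Literature.AlgebraicGeometry.Motives
open scoped MonObj

variable {S S' : Scheme.{u}} {A : AbelianSchemeOver S} {A' : AbelianSchemeOver S'} {g N M : ℕ}
  {φ : A.LevelStructure g N} {ψ : A'.LevelStructure g M} {Ω : Type u} [Field Ω]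
  {s : Spec (.of Ω) ⟶ S} {s' : Spec (.of Ω) ⟶ S'} {δ : Fin g → ℕ}

/-- **TRANSPORT WITH A CHANGE OF LEVEL.**  Let `e : A′_{s′} ≅ A_s` be an isomorphism of abelian varieties over `Ω`
between the fibre of `A′/S′` at `s′` and the fibre of `A/S` at `s`, `N ∣ M`, `Λ` a symplectic lift of the level-`N`
structure `φ` at `s` for the witness `Θ`, and `ψ` a level-`M` structure on `A′` whose sections at `s′` are carried by `e`
onto the level-`M` stage of the tower: `e(ψᵢ(s′)) = Λ.lift M (eᵢ)`.  Then `ψ` has a symplectic lift at `s′` for `e^*Θ`: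
roots `ζ_{M″} := Λ.ζ_{M″}`, tower `lift′_{M″} := e⁻¹ ∘ Λ.lift_{M″}` on the levels `M ∣ M″` (all divisible by `N`),
bijective and compatible because `Λ`'s tower is, equal to `ψ(s′)` at level `M` by `he`, and symplectic by Mumford's
functoriality `ē^{e^*Θ}_{M″}(e⁻¹P, e⁻¹Q) = ē^Θ_{M″}(P, Q)` (★ `weilPairingLevel_pullback_eq`).
[cite: Lan2013PELCompactifications, §1.3.6 Def. 1.3.6.2 (p. 80) and Lemma 1.3.6.5 (p. 81)]
[cite: MumfordAV1970, §20 (property (3) of e_n, p. 186)] -/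
theorem LevelStructure.SymplecticLift.nonempty_transport_relevel
    (e : (A'.fibre s').toAbelianVariety ≅ (A.fibre s).toAbelianVariety) (hNM : N ∣ M)
    {Θ : CartierDivisor (A.fibre s).toAbelianVariety.X.left} (Λ : φ.SymplecticLift s Θ δ)
    (he : ∀ i : Fin g ⊕ Fin g,
      AlgPoints.map e.hom.hom.hom.hom (A'.restrictPt s' (ψ.σ i)) =
        ((Λ.lift M (Multiplicative.ofAdd (Pi.single i 1)) :
            (A.fibre s).toAbelianVariety.torsionPoints Ω (M : ℤ)) : (A.fibre s).toAbelianVariety.Points Ω)) :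
    haveI := AbelianVariety.isDominant_toSchemeHom_iso_hom e
    Nonempty (ψ.SymplecticLift s' (Θ.pullback (AbelianVariety.Hom.toSchemeHom e.hom)) δ) := by
  -- adapted from ★ (T1) `LevelStructure.SymplecticLift.nonempty_transport` (level `N` replaced by `M`, `N ∣ M`)
  haveI := AbelianVariety.isDominant_toSchemeHom_iso_hom e
  -- the maps on `Ω`-points induced by `e` and `e⁻¹`
  let fwd : (A'.fibre s').toAbelianVariety.Points Ω →* (A.fibre s).toAbelianVariety.Points Ω :=
    IsMonHom.monoidHom e.hom.hom.hom.hom (specOver Ω Ω)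
  let bwd : (A.fibre s).toAbelianVariety.Points Ω →* (A'.fibre s').toAbelianVariety.Points Ω :=
    IsMonHom.monoidHom e.inv.hom.hom.hom (specOver Ω Ω)
  have hfwd : ∀ P, fwd P = AlgPoints.map e.hom.hom.hom.hom P := fun P => rfl
  have hfb : ∀ P, fwd (bwd P) = P := fun P => by
    change AlgPoints.map e.hom.hom.hom.hom (AlgPoints.map e.inv.hom.hom.hom P) = P
    rw [← AlgPoints.map_comp_apply]
    change AlgPoints.map (e.inv ≫ e.hom).hom.hom.hom P = P
    rw [e.inv_hom_id]
    exact AlgPoints.map_id_apply P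
  have hbf : ∀ P, bwd (fwd P) = P := fun P => by
    change AlgPoints.map e.inv.hom.hom.hom (AlgPoints.map e.hom.hom.hom.hom P) = P
    rw [← AlgPoints.map_comp_apply]
    change AlgPoints.map (e.hom ≫ e.inv).hom.hom.hom P = P
    rw [e.hom_inv_id]
    exact AlgPoints.map_id_apply P
  -- `e⁻¹` on the `M″`-torsion
  have hbwd_mem : ∀ (M'' : ℕ) (P : (A.fibre s).toAbelianVariety.torsionPoints Ω (M'' : ℤ)),
      bwd P ∈ (A'.fibre s').toAbelianVariety.torsionPoints Ω (M'' : ℤ) := fun M'' P => by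
    rw [AbelianVariety.mem_torsionPoints_iff, ← map_zpow, (AbelianVariety.mem_torsionPoints_iff _ _).1 P.2,
      map_one]
  let bwdT : ∀ M'' : ℕ, (A.fibre s).toAbelianVariety.torsionPoints Ω (M'' : ℤ) →*
      (A'.fibre s').toAbelianVariety.torsionPoints Ω (M'' : ℤ) := fun M'' =>
    (bwd.comp ((A.fibre s).toAbelianVariety.torsionPoints Ω (M'' : ℤ)).subtype).codRestrict _ (hbwd_mem M'')
  have hbwdT : ∀ (M'' : ℕ) (P : (A.fibre s).toAbelianVariety.torsionPoints Ω (M'' : ℤ)),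
      ((bwdT M'' P : (A'.fibre s').toAbelianVariety.torsionPoints Ω (M'' : ℤ)) :
        (A'.fibre s').toAbelianVariety.Points Ω) = bwd P := fun M'' P => rfl
  refine ⟨{ ζ := Λ.ζ
            isPrimitiveRoot_ζ := fun M'' hM'' hM''₀ => Λ.isPrimitiveRoot_ζ (dvd_trans hNM hM'') hM''₀
            ζ_pow := fun M'' k hM'' hM''₀ hk => Λ.ζ_pow k (dvd_trans hNM hM'') hM''₀ hk
            lift := fun M'' => (bwdT M'').comp (Λ.lift M'')
            lift_bijective := ?_
            lift_compat := ?_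
            lift_level := ?_
            pairing := ?_ }⟩
  · -- bijectivity: `e⁻¹` is a bijection on torsion points
    intro M'' hM'' hM''₀
    have hinj : Function.Injective (bwdT M'') := fun P Q hPQ => by
      have h := congrArg (fun R : (A'.fibre s').toAbelianVariety.torsionPoints Ω (M'' : ℤ) =>
        fwd (R : (A'.fibre s').toAbelianVariety.Points Ω)) hPQ
      simp only [hbwdT, hfb] at h
      exact Subtype.ext h
    have hsurj : Function.Surjective (bwdT M'') := fun Q => by
      have hQ' : fwd Q ∈ (A.fibre s).toAbelianVariety.torsionPoints Ω (M'' : ℤ) := by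
        rw [AbelianVariety.mem_torsionPoints_iff, ← map_zpow, (AbelianVariety.mem_torsionPoints_iff _ _).1 Q.2,
          map_one]
      refine ⟨⟨fwd Q, hQ'⟩, Subtype.ext ?_⟩
      rw [hbwdT]
      exact hbf Q
    rw [MonoidHom.coe_comp]
    exact (show Function.Bijective (bwdT M'') from ⟨hinj, hsurj⟩).comp (Λ.lift_bijective (dvd_trans hNM hM'') hM''₀)
  · -- tower compatibility
    intro M'' k x hM'' hM''₀ hk
    change bwd _ = (bwd _ : (A'.fibre s').toAbelianVariety.Points Ω) ^ k
    rw [← map_pow]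
    exact congrArg bwd (Λ.lift_compat k x (dvd_trans hNM hM'') hM''₀ hk)
  · -- level `M`: `e⁻¹(Λ.lift M (eᵢ)) = ψᵢ(s′)`
    intro i
    change bwd ((Λ.lift M (Multiplicative.ofAdd (Pi.single i 1)) :
        (A.fibre s).toAbelianVariety.torsionPoints Ω (M : ℤ)) : (A.fibre s).toAbelianVariety.Points Ω) = _
    rw [← he i, ← hfwd, hbf]
  · -- the pairing clause: `ē^{e^*Θ}(e⁻¹P, e⁻¹Q) = ē^Θ(P, Q) = ζ_{M″} ^ E_δ`
    intro M'' hM'' hM''Ω x y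
    haveI := AbelianVariety.isDominant_toSchemeHom_zsmul_of_ne_zero (A'.fibre s').toAbelianVariety hM''Ω
    haveI := AbelianVariety.isDominant_toSchemeHom_zsmul_of_ne_zero (A.fibre s).toAbelianVariety hM''Ω
    have hP : ((Λ.lift M'' (Multiplicative.ofAdd x) : (A.fibre s).toAbelianVariety.torsionPoints Ω (M'' : ℤ)) :
          (A.fibre s).toAbelianVariety.Points Ω) =
        AlgPoints.map e.hom.hom.hom.hom
          (((bwdT M'').comp (Λ.lift M'') (Multiplicative.ofAdd x) :
              (A'.fibre s').toAbelianVariety.torsionPoints Ω (M'' : ℤ)) :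
            (A'.fibre s').toAbelianVariety.Points Ω) := by
      rw [MonoidHom.comp_apply, hbwdT, ← hfwd, hfb]
    have hQ : ((Λ.lift M'' (Multiplicative.ofAdd y) : (A.fibre s).toAbelianVariety.torsionPoints Ω (M'' : ℤ)) :
          (A.fibre s).toAbelianVariety.Points Ω) =
        AlgPoints.map e.hom.hom.hom.hom
          (((bwdT M'').comp (Λ.lift M'') (Multiplicative.ofAdd y) :
              (A'.fibre s').toAbelianVariety.torsionPoints Ω (M'' : ℤ)) :
            (A'.fibre s').toAbelianVariety.Points Ω) := by
      rw [MonoidHom.comp_apply, hbwdT, ← hfwd, hfb]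
    have key := AbelianVariety.weilPairingLevel_pullback_eq e.hom Θ
      ((bwdT M'').comp (Λ.lift M'') (Multiplicative.ofAdd x)) ((bwdT M'').comp (Λ.lift M'') (Multiplicative.ofAdd y))
      (Λ.lift M'' (Multiplicative.ofAdd x)) (Λ.lift M'' (Multiplicative.ofAdd y)) hP hQ
    have hΛ := Λ.weilPairingLevel_lift (dvd_trans hNM hM'') hM''Ω x y
    convert key.trans hΛ using 1

/-- **RISE OF LEVEL at a fixed point**: a symplectic lift `Λ` of the level-`N` structure `φ` at `s` for `Θ` is a symplectic
lift of every level-`M` structure `ψ` on the same abelian scheme (`N ∣ M`) whose sections at `s` ARE the level-`M` stage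
of the tower, `ψᵢ(s) = Λ.lift M (eᵢ)` — the two levels of one tower `α̂` ([Lan2013PELCompactifications] Def. 1.3.6.2 (4));
the special case `e = 𝟙` of `nonempty_transport_relevel`, with `𝟙^*Θ ∼ Θ` (★ (T0) `nonempty_of_linEquiv`).
[cite: Lan2013PELCompactifications, §1.3.6 Def. 1.3.6.2 (p. 80) and Lemma 1.3.6.5 (p. 81)] -/
theorem LevelStructure.SymplecticLift.nonempty_relevel {ψ : A.LevelStructure g M} (hNM : N ∣ M)
    {Θ : CartierDivisor (A.fibre s).toAbelianVariety.X.left} (Λ : φ.SymplecticLift s Θ δ)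
    (he : ∀ i : Fin g ⊕ Fin g, A.restrictPt s (ψ.σ i) =
      ((Λ.lift M (Multiplicative.ofAdd (Pi.single i 1)) :
          (A.fibre s).toAbelianVariety.torsionPoints Ω (M : ℤ)) : (A.fibre s).toAbelianVariety.Points Ω)) :
    Nonempty (ψ.SymplecticLift s Θ δ) := by
  haveI := AbelianVariety.isDominant_toSchemeHom_iso_hom (Iso.refl (A.fibre s).toAbelianVariety)
  have he' : ∀ i : Fin g ⊕ Fin g,
      AlgPoints.map (Iso.refl (A.fibre s).toAbelianVariety).hom.hom.hom.hom (A.restrictPt s (ψ.σ i)) =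
        ((Λ.lift M (Multiplicative.ofAdd (Pi.single i 1)) :
            (A.fibre s).toAbelianVariety.torsionPoints Ω (M : ℤ)) : (A.fibre s).toAbelianVariety.Points Ω) :=
    fun i => (AlgPoints.map_id_apply _).trans (he i)
  obtain ⟨Λ'⟩ := Λ.nonempty_transport_relevel (ψ := ψ) (Iso.refl _) hNM he'
  -- `𝟙^*Θ` is the same divisor as `Θ`
  have hsame : (Θ.pullback (AbelianVariety.Hom.toSchemeHom
      (Iso.refl (A.fibre s).toAbelianVariety).hom)).SameDivisor Θ :=
    Θ.pullback_id_sameDivisor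
  exact Λ'.nonempty_of_linEquiv hsame.linEquiv

end AbelianSchemeOver

end Literature.AlgebraicGeometry.AbelianSchemes

end
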